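import Summits.SmoothPoincare4.SmoothPoincare4.Theorems.EntropyRungChangGurskyYangStubSmoothRoundLimitLimitRoundAux
import Summits.SmoothPoincare4.SmoothPoincare4.Theorems.EntropyRungChangGurskyYangStubSmoothRoundLimitChartDataAux
import Summits.SmoothPoincare4.SmoothPoincare4.Theorems.EntropyRungChangGurskyYangStubSmoothRoundLimitDecayOne
import HarnessLib

/-!
# The smooth chart-limit of the scaled metrics is round, II: `Ric(g') = g'/2`, `W(g') = 0`,
# constant sectional curvature `1/6`
(stub `helper_scaledLimit_round`, layer S5b of `stub_smoothRoundLimit`, line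
`margerin-cone-hamilton-rails`, crux `EntropyRung.ChangGurskyYang`, item stmt-SmoothPoincare4-10834)

Along a Ricci flow `g(t)` of Riemannian metrics on `[0, T)` on a closed `4`-manifold with the
roundness rates `|(T−t)R − 2| ≤ C(T−t)^δ`, `(T−t)²(|Ric|² − R²/4) ≤ C(T−t)^{2δ}`,
`(T−t)²(|Rm|² − 2|Ric|² + R²/3) ≤ C(T−t)^δ` on `[t₀, T)`, let `g'` be a Riemannian `C^∞` metric
whose chart representatives are, on a chart ball around every point, the `C^∞` limits as
`t ↑ T` of the representatives of the scaled metrics `g(t)/(T−t)` (the output of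
`helper_scaledLimit_metric`, Hamilton 1982, §17, Cor. 17.10). Then `g'` has constant sectional
curvature `1/6` (Hamilton 1982, §17, Cor. 17.11: "the limit metric … has constant positive
sectional curvature"): `Ric(g') = g'/2` and `W(g') = 0`, and an Einstein `4`-metric with
vanishing Weyl tensor has constant curvature `λ/3` (Besse 1987, 1.114–1.118; the tree's
`hasConstantSectionalCurvature_of_ricci_eq_of_weylFrame_eq_zero`).

* `scaledLimit_ricci_and_curvNormSq` — at every point `z`, `Ric(g')(z) = g'(z)/2` and
  `|Rm(g')|²(z) = 2/3`: at the centre of the chart at `z`, along `tₙ ↑ T`, the 2-jets of the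
  scaled representatives converge (`jets_of_tendsto_iteratedFDeriv`), the Einstein defect
  `Ric(G̃ₙ) − G̃ₙ/2` decays in operator norm (`norm_ricAt_sub_smul_chartRep_le`, scale
  invariance of `Ric`) while `Ric(G̃ₙ) → Ric(G')` (`tendsto_ricAt_apply`, Petersen 2006, Ch. 10,
  §3.2), and `|Rm(G̃ₙ)|² = (T−tₙ)²|Rm(g(tₙ))|² → 2/3` (`helper_scaledCurvNormSq_tendsto`, with
  `|E|², |W|² ≥ 0` from `traceless_weyl_nonneg`) while `|Rm(G̃ₙ)|² → |Rm(G')|²`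
  (`tendsto_rmNormSqAt`);
* `helper_scaledLimit_round` — the registered statement: `R = 2`, `|Ric|² = 1`,
  `|W|² = |Rm|² − 2|Ric|² + R²/3 = 0` (`weylNormSq_eq_curvNormSqWith`), every frame Weyl component
  vanishes (`weylFrame_eq_zero_of_weylNormSq_eq_zero`), constant sectional curvature `1/6`.

## References

* R. S. Hamilton, *Three-manifolds with positive Ricci curvature*, J. Differential Geom. 17
  (1982) 255–306, §17, Thm. 17.6, Cor. 17.10, Cor. 17.11. [Hamilton1982]
* A. L. Besse, *Einstein Manifolds* (1987), 1.114–1.118. [Besse1987]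
* P. Petersen, *Riemannian Geometry*, 2nd ed., GTM 171, Springer 2006, Ch. 10, §3.2 (curvature
  under `C²` convergence of metrics). [Petersen2006]
-/

noncomputable section

-- every `Summit.SmoothPoincare4.SmoothPoincare4.…` name repeats the summit = sub-problem segment (D-0017 layout)
set_option linter.dupNamespace false

-- operator spaces of bilinear forms over the model space
set_option maxSynthPendingDepth 3

open Set Function Filter Module Metric
open scoped Manifold ContDiff Topology

namespace Summit.SmoothPoincare4.SmoothPoincare4.Theorems.MargerinRails

open Literature.Geometry.Riemannian
open Literature.Geometry.Lorentzian Literature.Geometry.Lorentzian.PseudoRiemannianMetric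
open Literature.Geometry.Lorentzian.MetricCoord

/-! ### The limit metric at a point: `Ric(g') = g'/2` and `|Rm(g')|² = 2/3` -/

section Pointwise

variable {M : Type*} [TopologicalSpace M] [ChartedSpace (EuclideanSpace ℝ (Fin 4)) M]
  [IsManifold (𝓡 4) ∞ M]
  {g : ℝ → PseudoRiemannianMetric (𝓡 4) ∞ (EuclideanSpace ℝ (Fin 4)) (TangentSpace (𝓡 4) : M → Type _)}
  {cov : ℝ → CovariantDerivative (𝓡 4) (EuclideanSpace ℝ (Fin 4)) (TangentSpace (𝓡 4) : M → Type _)}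
  {T δ C t₀ : ℝ}

/-- **The smooth chart-limit of `g(t)/(T−t)` is Einstein with `|Rm|² = 2/3` at every point**
(Hamilton 1982, §17, Cor. 17.11, through Petersen's "curvature passes to `C²` limits of the metric
components", 2006, Ch. 10, §3.2). At the centre `ẑ` of the chart at `z`, along `tₙ ↑ T`: the
2-jets of the scaled representatives `G̃ₙ` converge to the 2-jet of the representative `G'` of
`g'` (`jets_of_tendsto_iteratedFDeriv`); `Ric(G̃ₙ)(ẑ) − G̃ₙ(ẑ)/2 → 0` in operator norm
(`norm_ricAt_sub_smul_chartRep_le`, scale invariance of `Ric`) while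
`Ric(G̃ₙ)(ẑ) → Ric(G')(ẑ)` (`tendsto_ricAt_apply`), so `Ric(G')(ẑ) = G'(ẑ)/2`, i.e.
`Ric(g')(z) = g'(z)/2` (`ricAt_chartRep_const_eq`, `dΦ` invertible); and
`|Rm(G̃ₙ)|²(ẑ) = (T−tₙ)²|Rm(g(tₙ))|²(z) → 2/3` by the roundness rates
(`tendsto_scaled_curvNormSq`) while `|Rm(G̃ₙ)|²(ẑ) → |Rm(G')|²(ẑ)` (`tendsto_rmNormSqAt`), so
`|Rm(g')|²(z) = 2/3` (`curvNormSqWith_chartInv_eq'`). [cite: Hamilton1982, §17, Cor. 17.11]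
[cite: Petersen2006, Ch. 10, §3.2] -/
theorem scaledLimit_ricci_and_curvNormSq (hT : 0 < T) (hflow : IsRicciFlow g cov (Ico 0 T))
    (hRiem : ∀ t ∈ Ico 0 T, (g t).IsRiemannian) (hδ : 0 < δ) (ht₀ : t₀ ∈ Ico 0 T)
    (hrate : ∀ t ∈ Ico t₀ T, ∀ x : M,
      |(T - t) * (g t).scalarCurvatureWith (cov t) x - 2| ≤ C * (T - t) ^ δ ∧
      (T - t) ^ 2 * ((g t).normSq x ((cov t).ricci x) -
        (g t).scalarCurvatureWith (cov t) x ^ 2 / 4) ≤ C * (T - t) ^ (2 * δ) ∧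
      (T - t) ^ 2 * ((g t).curvNormSqWith (cov t) x - 2 * (g t).normSq x ((cov t).ricci x) +
        (g t).scalarCurvatureWith (cov t) x ^ 2 / 3) ≤ C * (T - t) ^ δ)
    (g' : PseudoRiemannianMetric (𝓡 4) ∞ (EuclideanSpace ℝ (Fin 4)) (TangentSpace (𝓡 4) : M → Type _))
    [g'.HasLeviCivita] (z : M) {r : ℝ} (hr : 0 < r)
    (hcl : closedBall (extChartAt (𝓡 4) z z) r ⊆ (extChartAt (𝓡 4) z).target)
    (hcv : ∀ m : ℕ, ∀ ε : ℝ, 0 < ε → ∃ t₂ ∈ Ico 0 T, ∀ t ∈ Ico t₂ T,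
      ∀ y ∈ ball (extChartAt (𝓡 4) z z) r,
        ‖iteratedFDeriv ℝ m (fun y : EuclideanSpace ℝ (Fin 4) ↦ (T - t)⁻¹ • chartRep (𝓡 4) g z t y) y -
          iteratedFDeriv ℝ m (fun y : EuclideanSpace ℝ (Fin 4) ↦ chartRep (𝓡 4) (fun _ : ℝ ↦ g') z 0 y) y‖
          ≤ ε) :
    (∀ X Y : TangentSpace (𝓡 4) z, g'.ricci z X Y = 1 / 2 * g'.val z X Y) ∧
      g'.curvNormSqWith g'.leviCivita z = 2 / 3 := by
  have hrate2 : ∀ t ∈ Ico t₀ T, ∀ x : M,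
      |(T - t) * (g t).scalarCurvatureWith (cov t) x - 2| ≤ C * (T - t) ^ δ ∧
      (T - t) ^ 2 * ((g t).normSq x ((cov t).ricci x) -
        (g t).scalarCurvatureWith (cov t) x ^ 2 / 4) ≤ C * (T - t) ^ (2 * δ) :=
    fun t ht x ↦ ⟨(hrate t ht x).1, (hrate t ht x).2.1⟩
  -- the centre of the chart
  set y₀ : EuclideanSpace ℝ (Fin 4) := extChartAt (𝓡 4) z z with hy₀def
  have hy₀t : y₀ ∈ (extChartAt (𝓡 4) z).target := mem_extChartAt_target z
  have hy₀b : y₀ ∈ ball y₀ r := mem_ball_self hr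
  have hy₀c : y₀ ∈ closedBall y₀ r := mem_closedBall_self hr.le
  set u₀ : chartTarget (𝓡 4) z := ⟨y₀, hy₀t⟩ with hu₀def
  have hu₀ : chartInv (𝓡 4) z u₀ = z := extChartAt_to_inv z
  set L := mfderiv 𝓘(ℝ, EuclideanSpace ℝ (Fin 4)) (𝓡 4) (chartInv (𝓡 4) z) u₀ with hL
  have hLi : L.IsInvertible :=
    isInvertible_mfderiv_of_injective rfl (injective_mfderiv_chartInv z u₀)
  -- two-sided bounds of the scaled representative on the closed ball
  obtain ⟨lam, Λ, -, hbd⟩ := scaledChartRep_twoSided hflow hRiem hδ ht₀ hrate2 z hr.le hcl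
  -- the time sequence and the scaled metrics
  obtain ⟨s, ht, hsT⟩ := exists_seq_tendsto hT
  have hTt : ∀ n, 0 < T - s n := fun n ↦ sub_pos.2 (ht n).2
  set gs : ℕ → PseudoRiemannianMetric (𝓡 4) ∞ (EuclideanSpace ℝ (Fin 4)) (TangentSpace (𝓡 4) : M → Type _) :=
    fun n ↦ (g (s n)).constSmul (T - s n)⁻¹ (inv_ne_zero (hTt n).ne') with hgs
  have hLCs : ∀ n, (gs n).IsLeviCivita (cov (s n)) := fun n ↦
    (hflow.isLeviCivita (s n) (ht n)).constSmul _ _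
  set Gs : ℕ → EuclideanSpace ℝ (Fin 4) → EuclideanSpace ℝ (Fin 4) →L[ℝ] EuclideanSpace ℝ (Fin 4) →L[ℝ] ℝ :=
    fun n ↦ chartRep (𝓡 4) (fun _ ↦ gs n) z 0 with hGs
  set G' : EuclideanSpace ℝ (Fin 4) → EuclideanSpace ℝ (Fin 4) →L[ℝ] EuclideanSpace ℝ (Fin 4) →L[ℝ] ℝ :=
    chartRep (𝓡 4) (fun _ ↦ g') z 0 with hG'
  have hGs_eq : ∀ n, (fun y : EuclideanSpace ℝ (Fin 4) ↦
      (T - s n)⁻¹ • chartRep (𝓡 4) g z (s n) y) = Gs n :=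
    fun n ↦ (chartRep_constSmul z (s n) _ _).symm
  have hGsm : ∀ n, IsMetricOn (Gs n) (extChartAt (𝓡 4) z).target := fun n ↦
    isMetricOn_chartRep_const (gs n) z
  have hG'm : IsMetricOn G' (extChartAt (𝓡 4) z).target := isMetricOn_chartRep_const g' z
  -- the jets converge at the centre along the sequence
  have hjet : ∀ m : ℕ, Tendsto (fun n ↦ iteratedFDeriv ℝ m (Gs n) y₀) atTop
      (𝓝 (iteratedFDeriv ℝ m G' y₀)) := by
    intro m
    rw [Metric.tendsto_nhds]
    intro ε hε
    obtain ⟨t₂, ht₂, hb⟩ := hcv m (ε / 2) (half_pos hε)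
    filter_upwards [eventually_le_of_tendsto hsT ht₂.2] with n hn
    have h := hb (s n) ⟨hn, (ht n).2⟩ y₀ hy₀b
    rw [hGs_eq n] at h
    rw [dist_eq_norm]
    exact lt_of_le_of_lt h (half_lt_self hε)
  obtain ⟨hj0, hj1, hj2⟩ := jets_of_tendsto_iteratedFDeriv hjet
  constructor
  · -- (A) `Ric(G')(ẑ) = G'(ẑ)/2`
    have hchart : ∀ v w : EuclideanSpace ℝ (Fin 4), ricAt G' y₀ v w = 1 / 2 * G' y₀ v w := by
      intro v w
      have hlim1 : Tendsto (fun n ↦ ricAt (Gs n) y₀ v w - 1 / 2 * Gs n y₀ v w) atTop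
          (𝓝 (ricAt G' y₀ v w - 1 / 2 * G' y₀ v w)) :=
        (tendsto_ricAt_apply hGsm hG'm hy₀t hj0 hj1 hj2 v w).sub
          ((tendsto_clm_apply_const (tendsto_clm_apply_const hj0 v) w).const_mul _)
      have hlim0 : Tendsto (fun n ↦ ricAt (Gs n) y₀ v w - 1 / 2 * Gs n y₀ v w) atTop (𝓝 0) := by
        have hb0 : Tendsto (fun n ↦ Real.sqrt (C ^ 2 + 4 * C) * Λ * (T - s n) ^ δ *
            ‖v‖ * ‖w‖) atTop (𝓝 0) := by
          have h := ((((tendsto_const_sub_of_tendsto hsT).rpow_const (Or.inr hδ.le)).const_mul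
            (Real.sqrt (C ^ 2 + 4 * C) * Λ)).mul_const ‖v‖).mul_const ‖w‖
          rw [Real.zero_rpow hδ.ne', mul_zero, zero_mul, zero_mul] at h
          exact h
        refine squeeze_zero_norm' ?_ hb0
        filter_upwards [eventually_le_of_tendsto hsT ht₀.2] with n hn
        have htn : s n ∈ Ico t₀ T := ⟨hn, (ht n).2⟩
        have hΛ := (hbd (s n) htn y₀ hy₀c).2
        have hnorm := norm_ricAt_sub_smul_chartRep_le hflow hRiem ht₀ hrate2 z hy₀t htn hΛ
        have e1 : ricAt (Gs n) y₀ v w = ricAt (chartRep (𝓡 4) g z (s n)) y₀ v w :=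
          (ricAt_chartRep_const_eq (gs n) (hLCs n) z u₀ v w).trans
            (ricAt_chartRep_const_eq (g (s n)) (hflow.isLeviCivita _ (ht n)) z u₀ v w).symm
        have e2 : Gs n y₀ v w = (T - s n)⁻¹ * chartRep (𝓡 4) g z (s n) y₀ v w := by
          rw [← hGs_eq n]
          rfl
        rw [e1, e2, Real.norm_eq_abs]
        have hTn := hTt n
        calc |ricAt (chartRep (𝓡 4) g z (s n)) y₀ v w -
              1 / 2 * ((T - s n)⁻¹ * chartRep (𝓡 4) g z (s n) y₀ v w)|
            = |(ricAt (chartRep (𝓡 4) g z (s n)) y₀ -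
                (2 * (T - s n))⁻¹ • chartRep (𝓡 4) g z (s n) y₀) v w| := by
              congr 1
              simp only [_root_.sub_apply, _root_.smul_apply, smul_eq_mul, mul_inv]
              ring
          _ ≤ ‖ricAt (chartRep (𝓡 4) g z (s n)) y₀ -
                (2 * (T - s n))⁻¹ • chartRep (𝓡 4) g z (s n) y₀‖ * ‖v‖ * ‖w‖ :=
              abs_apply₂_le _ v w
          _ ≤ Real.sqrt (C ^ 2 + 4 * C) * Λ * (T - s n) ^ δ * ‖v‖ * ‖w‖ := by
              gcongr
      have := tendsto_nhds_unique hlim1 hlim0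
      linarith
    -- back on the manifold, at the point `Φ(ẑ) = z`
    have key : ∀ X Y : TangentSpace (𝓡 4) (chartInv (𝓡 4) z u₀),
        g'.ricci (chartInv (𝓡 4) z u₀) X Y = 1 / 2 * g'.val (chartInv (𝓡 4) z u₀) X Y := by
      intro X Y
      have h := hchart (L.inverse X) (L.inverse Y)
      have hric := ricAt_chartRep_const_eq g' g'.isLeviCivita_leviCivita_holds z u₀
        (L.inverse X) (L.inverse Y)
      rw [← hL, hLi.self_apply_inverse, hLi.self_apply_inverse] at hric
      have hval : G' y₀ (L.inverse X) (L.inverse Y) = g'.val (chartInv (𝓡 4) z u₀) X Y := by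
        rw [hG', chartRep_apply (fun _ ↦ g') z 0 u₀, val_chartPullback_apply, ← hL,
          hLi.self_apply_inverse, hLi.self_apply_inverse]
      rw [hval] at h
      rw [← h]
      exact hric.symm
    rw [hu₀] at key
    exact key
  · -- (B) `|Rm(G')|²(ẑ) = 2/3`
    have hlim1 := tendsto_rmNormSqAt hGsm hG'm hy₀t hj0 hj1 hj2
    have hid : ∀ n, rmNormSqAt (Gs n) y₀ =
        (T - s n) ^ 2 * (g (s n)).curvNormSqWith (cov (s n)) z := by
      intro n
      have h := curvNormSqWith_chartInv_eq' (hLCs n) z u₀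
      rw [hu₀] at h
      calc rmNormSqAt (Gs n) y₀ = (gs n).curvNormSqWith (cov (s n)) z := h.symm
        _ = (T - s n)⁻¹⁻¹ ^ 2 * (g (s n)).curvNormSqWith (cov (s n)) z :=
            curvNormSqWith_constSmul_eq _ _ _ _ z
        _ = (T - s n) ^ 2 * (g (s n)).curvNormSqWith (cov (s n)) z := by
            rw [inv_inv]
    have hlim2 : Tendsto (fun n ↦ rmNormSqAt (Gs n) y₀) atTop (𝓝 (2 / 3)) := by
      rw [show (fun n ↦ rmNormSqAt (Gs n) y₀) =
          fun n ↦ (T - s n) ^ 2 * (g (s n)).curvNormSqWith (cov (s n)) z from funext hid]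
      refine tendsto_scaled_curvNormSq
        (R := fun n ↦ (g (s n)).scalarCurvatureWith (cov (s n)) z)
        (N := fun n ↦ (g (s n)).normSq z ((cov (s n)).ricci z)) (C := C) hδ
        (tendsto_const_sub_of_tendsto hsT) ?_ ?_ ?_ ?_ ?_
      · filter_upwards [eventually_le_of_tendsto hsT ht₀.2] with n hn
        exact (hrate _ ⟨hn, (ht n).2⟩ z).1
      · filter_upwards [eventually_le_of_tendsto hsT ht₀.2] with n hn
        exact (hrate _ ⟨hn, (ht n).2⟩ z).2.1
      · filter_upwards [eventually_le_of_tendsto hsT ht₀.2] with n hn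
        exact (hrate _ ⟨hn, (ht n).2⟩ z).2.2
      · exact Eventually.of_forall fun n ↦ (traceless_weyl_nonneg hflow hRiem (ht n) z).1
      · exact Eventually.of_forall fun n ↦ (traceless_weyl_nonneg hflow hRiem (ht n) z).2
    have hRm : rmNormSqAt G' y₀ = 2 / 3 := tendsto_nhds_unique hlim1 hlim2
    have h := curvNormSqWith_chartInv_eq' (g := g') g'.isLeviCivita_leviCivita_holds z u₀
    rw [hu₀] at h
    rw [h]
    exact hRm

end Pointwise

/-! ### The registered helper -/

/-- **HELPER `helper_scaledLimit_round` — ANY SMOOTH CHART-LIMIT OF `g(t)/(T−t)` UNDER THE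
ROUNDNESS RATES IS ROUND** (layer S5b of `stub_smoothRoundLimit`; Hamilton 1982, §17,
Cor. 17.11: the limit metric is Einstein, `Ric(g') = g'/2`, with vanishing Weyl tensor, hence of
constant sectional curvature `1/6` by the decomposition of the curvature tensor, Besse 1987,
1.114–1.118; curvature passes to `C²` limits of the metric components, Petersen 2006, Ch. 10,
§3.2). Along a Ricci flow of Riemannian metrics on `[0, T)` on a closed `4`-manifold with
`|(T−t)R − 2| ≤ C(T−t)^δ`, `(T−t)²(|Ric|² − R²/4) ≤ C(T−t)^{2δ}`,
`(T−t)²(|Rm|² − 2|Ric|² + R²/3) ≤ C(T−t)^δ` on `[t₀, T)`, every Riemannian `C^∞` metric `g'`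
whose chart representatives are `C^∞`-limits of the scaled representatives on chart balls has
constant sectional curvature `1/6`: pointwise `Ric(g') = g'/2` and `|Rm(g')|² = 2/3`
(`scaledLimit_ricci_and_curvNormSq`), so `R = 2`, `|Ric|² = 1`, `|W|² = |Rm|² − 2|Ric|² + R²/3 = 0`
(`weylNormSq_eq_curvNormSqWith`), all frame Weyl components vanish
(`weylFrame_eq_zero_of_weylNormSq_eq_zero`), and
`hasConstantSectionalCurvature_of_ricci_eq_of_weylFrame_eq_zero` concludes.
[cite: Hamilton1982, §17, Cor. 17.11] [cite: Besse1987, 1.118] [cite: Petersen2006, Ch. 10, §3.2] -/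
theorem helper_scaledLimit_round : ∀ (M : Type) [TopologicalSpace M] [T2Space M] [SecondCountableTopology M] [ChartedSpace (EuclideanSpace ℝ (Fin 4)) M] [IsManifold (𝓡 4) ∞ M] [CompactSpace M] (g : ℝ → PseudoRiemannianMetric (𝓡 4) ∞ (EuclideanSpace ℝ (Fin 4)) (TangentSpace (𝓡 4) : M → Type _)) (cov : ℝ → CovariantDerivative (𝓡 4) (EuclideanSpace ℝ (Fin 4)) (TangentSpace (𝓡 4) : M → Type _)) (T : ℝ), 0 < T → IsRicciFlow g cov (Ico 0 T) → (∀ t ∈ Ico 0 T, (g t).IsRiemannian) → ∀ (δ C t₀ : ℝ), 0 < δ → t₀ ∈ Ico 0 T → (∀ t ∈ Ico t₀ T, ∀ x : M, |(T - t) * (g t).scalarCurvatureWith (cov t) x - 2| ≤ C * (T - t) ^ δ ∧ (T - t) ^ 2 * ((g t).normSq x ((cov t).ricci x) - (g t).scalarCurvatureWith (cov t) x ^ 2 / 4) ≤ C * (T - t) ^ (2 * δ) ∧ (T - t) ^ 2 * ((g t).curvNormSqWith (cov t) x - 2 * (g t).normSq x ((cov t).ricci x) + (g t).scalarCurvatureWith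 (cov t) x ^ 2 / 3) ≤ C * (T - t) ^ δ) → ∀ g' : PseudoRiemannianMetric (𝓡 4) ∞ (EuclideanSpace ℝ (Fin 4)) (TangentSpace (𝓡 4) : M → Type _), g'.IsRiemannian → (∀ z : M, ∃ r : ℝ, 0 < r ∧ Metric.closedBall (extChartAt (𝓡 4) z z) r ⊆ (extChartAt (𝓡 4) z).target ∧ ∀ m : ℕ, ∀ ε : ℝ, 0 < ε → ∃ t₂ ∈ Ico 0 T, ∀ t ∈ Ico t₂ T, ∀ y ∈ Metric.ball (extChartAt (𝓡 4) z z) r, ‖iteratedFDeriv ℝ m (fun y : EuclideanSpace ℝ (Fin 4) ↦ (T - t)⁻¹ • chartRep (𝓡 4) g z t y) y - iteratedFDeriv ℝ m (fun y : EuclideanSpace ℝ (Fin 4) ↦ chartRep (𝓡 4) (fun _ : ℝ ↦ g') z 0 y) y‖ ≤ ε) → g'.HasConstantSectionalCurvature (1 / 6) := by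
  intro M _ _ _ _ _ _ g cov T hT hflow hRiem δ C t₀ hδ ht₀ hrate g' hg' hconv
  haveI := g'.hasLeviCivita
  have h2 : (2 : ℕ∞ω) ≤ ∞ := WithTop.coe_le_coe.mpr le_top
  have key : ∀ z : M, (∀ X Y : TangentSpace (𝓡 4) z, g'.ricci z X Y = 1 / 2 * g'.val z X Y) ∧
      g'.curvNormSqWith g'.leviCivita z = 2 / 3 := by
    intro z
    obtain ⟨r, hr, hcl, hcv⟩ := hconv z
    exact scaledLimit_ricci_and_curvNormSq hT hflow hRiem hδ ht₀ hrate g' z hr hcl hcv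
  have hRic : ∀ (x : M) (X Y : TangentSpace (𝓡 4) x), g'.ricci x X Y = 1 / 2 * g'.val x X Y :=
    fun x ↦ (key x).1
  have hS : ∀ x : M, g'.scalarCurvature x = 2 := fun x ↦ by
    have h := scalarCurvature_eq_of_ricci_eq g' hg' finrank_euclideanFour hRic x
    norm_num at h
    exact h
  have hN : ∀ x : M, g'.normSq x (g'.ricci x) = 1 :=
    normSq_ricci_eq_one_of_ricci_eq_half g' hg' hRic
  have hW : ∀ (x : M) (e : Fin 4 → TangentSpace (𝓡 4) x), g'.IsOrthonormalFrame x e →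
      ∀ i j k l, g'.weylFrame x e i j k l = 0 := by
    intro x e he i j k l
    refine weylFrame_eq_zero_of_weylNormSq_eq_zero g' ?_ he i j k l
    rw [g'.weylNormSq_eq_curvNormSqWith hg' finrank_euclideanFour x, (key x).2, hN x, hS x]
    norm_num
  have h := hasConstantSectionalCurvature_of_ricci_eq_of_weylFrame_eq_zero g' h2 hg'
    finrank_euclideanFour hRic hW
  norm_num at h
  exact h

end Summit.SmoothPoincare4.SmoothPoincare4.Theorems.MargerinRails

end
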